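import Mathlib
import Summits.Ventures.PercRepro2.V2SP
import Summits.Ventures.PercRepro2.Tail2DCount
import Summits.Ventures.PercRepro2.Tail2DThreePoint
import Summits.Ventures.PercRepro2.Tail2DThreePointComm
import Summits.Ventures.PercRepro2.Tail2DFlowTwo
import Summits.Ventures.PercRepro2.Tail2DTransport

/-!
# `P(e²) ∧ Y` for an arbitrary pattern `Y`: the six flow counts as statistics of `Y` (seat mine-b, cell pub-perc-repro2)

A bundle of two free edges in series with ANY pattern `Y` has max-flow `≤ 2`, and its six flow counts
are statistics of the flow law of `Y`:
`n₂₀ = #{r ≥ 2}`, `n₀₂ = #{b ≥ 2}`, `n₁₁ = 2·#{r ≥ 1, b ≥ 1}`, `n₁₀ = #{r = 1} + 2·#{r ≥ 1, b = 0}`,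
`n₀₁ = #{b = 1} + 2·#{b ≥ 1, r = 0}`, `n₀₀ = #{r = 0} + #{b = 0} + 2·#{r = b = 0}`
(`p2ser_counts`). Hence the transport theorem `MTailPat.par_flow2'` becomes a rule with hypotheses on
`Y` alone (`MTailPat.par_p2ser`): whenever the nine transport inequalities hold for these statistics —
on the census they hold for every series–parallel `Y` with `≤ 11` edges and for every two-terminal
graph tested (registry §34.11) — parallel composition with `P(e²) ∧ Y` keeps the M♮ class. The wide
family `P(e²) ∧ P(e^D)` of `Tail2DWideFamily.lean` is the case `Y = bundle`.
-/

namespace Summit.Ventures.PercRepro2.Tail2D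

open V2Closure

/-- a bundle of two free edges in series with the pattern `Y` -/
def p2ser (Y : V2Closure.SP) : V2Closure.SP := .ser (.par .free .free) Y

/-- the number of configurations of `Y` satisfying a (decidable) condition on the two flows -/
def stat (Y : V2Closure.SP) (P : ℕ → ℕ → Prop) [DecidablePred fun y : Y.Conf => P (Y.rLab y) (Y.bLab y)] : ℕ :=
  (Finset.univ.filter (fun y : Y.Conf => P (Y.rLab y) (Y.bLab y))).card

/-- `p2ser Y` has max-flow `≤ 2` -/
theorem p2ser_flowLeTwo (Y : V2Closure.SP) : FlowLeTwo (p2ser Y) := by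
  unfold FlowLeTwo p2ser
  rintro ⟨⟨a1, a2⟩, y⟩
  cases a1 <;> cases a2 <;> simp [SP.rLab, SP.bLab, V2Closure.serR, V2Closure.serB, V2Closure.parR, V2Closure.parB] <;> omega

/-- the flow count of `p2ser Y` as a sum over the configurations of `Y` -/
lemma p2ser_flowCount (Y : V2Closure.SP) (i j : ℕ) :
    flowCount (p2ser Y) i j
      = ∑ y : Y.Conf, ((if min 2 (Y.rLab y) = i ∧ min 0 (Y.bLab y) = j then 1 else 0)
            + 2 * (if min 1 (Y.rLab y) = i ∧ min 1 (Y.bLab y) = j then 1 else 0)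
            + (if min 0 (Y.rLab y) = i ∧ min 2 (Y.bLab y) = j then 1 else 0)) := by
  unfold flowCount p2ser
  rw [Finset.card_filter]
  change (∑ p : (Bool × Bool) × Y.Conf, if min ((if p.1.1 then 0 else 1) + (if p.1.2 then 0 else 1)) (Y.rLab p.2) = i
      ∧ min ((if p.1.1 then 1 else 0) + (if p.1.2 then 1 else 0)) (Y.bLab p.2) = j then 1 else 0) = _
  rw [Fintype.sum_prod_type, Fintype.sum_prod_type, Fintype.sum_bool, Fintype.sum_bool, Fintype.sum_bool]
  simp only [Bool.false_eq_true, ↓reduceIte, add_zero, zero_add]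
  rw [← Finset.sum_add_distrib, ← Finset.sum_add_distrib, ← Finset.sum_add_distrib]
  refine Finset.sum_congr rfl (fun y _ => ?_)
  norm_num
  split_ifs <;> omega

/-- **the six flow counts of `P(e²) ∧ Y` are statistics of `Y`** -/
theorem p2ser_counts (Y : V2Closure.SP) :
    flowCount (p2ser Y) 2 0 = stat Y (fun r _ => 2 ≤ r) ∧
    flowCount (p2ser Y) 0 2 = stat Y (fun _ b => 2 ≤ b) ∧
    flowCount (p2ser Y) 1 1 = 2 * stat Y (fun r b => 1 ≤ r ∧ 1 ≤ b) ∧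
    flowCount (p2ser Y) 1 0 = stat Y (fun r _ => r = 1) + 2 * stat Y (fun r b => 1 ≤ r ∧ b = 0) ∧
    flowCount (p2ser Y) 0 1 = stat Y (fun _ b => b = 1) + 2 * stat Y (fun r b => 1 ≤ b ∧ r = 0) ∧
    flowCount (p2ser Y) 0 0 = stat Y (fun r _ => r = 0) + stat Y (fun _ b => b = 0) + 2 * stat Y (fun r b => r = 0 ∧ b = 0) := by
  refine ⟨?_, ?_, ?_, ?_, ?_, ?_⟩ <;> unfold stat <;> rw [p2ser_flowCount] <;>
    simp only [Finset.card_filter, Finset.mul_sum, ← Finset.sum_add_distrib] <;>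
    refine Finset.sum_congr rfl (fun y _ => ?_) <;> split_ifs <;> omega

/-- **parallel composition with `P(e²) ∧ Y` keeps the M♮ class** whenever the nine transport
inequalities hold for the statistics of `Y` (with `r2 = #{r ≥ 2}`, `b2 = #{b ≥ 2}`, `rb = #{r ≥ 1, b ≥ 1}`,
`r1 = #{r = 1}`, `r1b0 = #{r ≥ 1, b = 0}`, `b1 = #{b = 1}`, `b1r0 = #{b ≥ 1, r = 0}`, `r0 = #{r = 0}`,
`b0 = #{b = 0}`, `z = #{r = b = 0}`, the counts being `n₂₀ = r2`, `n₀₂ = b2`, `n₁₁ = 2 rb`,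
`n₁₀ = r1 + 2 r1b0`, `n₀₁ = b1 + 2 b1r0`, `n₀₀ = r0 + b0 + 2 z`) and `Y` attains red flow `≥ 2`,
blue flow `≥ 2` and both flows `≥ 1` -/
theorem MTailPat.par_p2ser {s : V2Closure.SP} {L : ℤ} (hs : MTailPat s L) (Y : V2Closure.SP)
    (h20 : ∃ y : Y.Conf, 2 ≤ Y.rLab y) (h02 : ∃ y : Y.Conf, 2 ≤ Y.bLab y) (h11 : ∃ y : Y.Conf, 1 ≤ Y.rLab y ∧ 1 ≤ Y.bLab y)
    (hR2 : (stat Y (fun r _ => r = 0) + stat Y (fun _ b => b = 0) + 2 * stat Y (fun r b => r = 0 ∧ b = 0)) * stat Y (fun r _ => 2 ≤ r)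
      ≤ (stat Y (fun r _ => r = 1) + 2 * stat Y (fun r b => 1 ≤ r ∧ b = 0)) * (stat Y (fun r _ => r = 1) + 2 * stat Y (fun r b => 1 ≤ r ∧ b = 0))
        + (stat Y (fun r _ => r = 1) + 2 * stat Y (fun r b => 1 ≤ r ∧ b = 0)) * stat Y (fun r _ => 2 ≤ r))
    (hC2 : (stat Y (fun r _ => r = 0) + stat Y (fun _ b => b = 0) + 2 * stat Y (fun r b => r = 0 ∧ b = 0)) * stat Y (fun _ b => 2 ≤ b)
      ≤ (stat Y (fun _ b => b = 1) + 2 * stat Y (fun r b => 1 ≤ b ∧ r = 0)) * (stat Y (fun _ b => b = 1) + 2 * stat Y (fun r b => 1 ≤ b ∧ r = 0))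
        + (stat Y (fun _ b => b = 1) + 2 * stat Y (fun r b => 1 ≤ b ∧ r = 0)) * stat Y (fun _ b => 2 ≤ b))
    (hS : stat Y (fun r _ => 2 ≤ r) * stat Y (fun _ b => 2 ≤ b) ≤ (2 * stat Y (fun r b => 1 ≤ r ∧ 1 ≤ b)) * (2 * stat Y (fun r b => 1 ≤ r ∧ 1 ≤ b)))
    (hE : stat Y (fun r _ => 2 ≤ r) * (stat Y (fun _ b => b = 1) + 2 * stat Y (fun r b => 1 ≤ b ∧ r = 0))
      ≤ (stat Y (fun r _ => r = 1) + 2 * stat Y (fun r b => 1 ≤ r ∧ b = 0)) * (2 * stat Y (fun r b => 1 ≤ r ∧ 1 ≤ b)))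
    (hE' : stat Y (fun _ b => 2 ≤ b) * (stat Y (fun r _ => r = 1) + 2 * stat Y (fun r b => 1 ≤ r ∧ b = 0))
      ≤ (stat Y (fun _ b => b = 1) + 2 * stat Y (fun r b => 1 ≤ b ∧ r = 0)) * (2 * stat Y (fun r b => 1 ≤ r ∧ 1 ≤ b)))
    (hR1 : (stat Y (fun r _ => r = 0) + stat Y (fun _ b => b = 0) + 2 * stat Y (fun r b => r = 0 ∧ b = 0)) * stat Y (fun r _ => 2 ≤ r)
      ≤ (stat Y (fun r _ => r = 1) + 2 * stat Y (fun r b => 1 ≤ r ∧ b = 0)) * (stat Y (fun r _ => r = 1) + 2 * stat Y (fun r b => 1 ≤ r ∧ b = 0))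
        + (stat Y (fun r _ => r = 1) + 2 * stat Y (fun r b => 1 ≤ r ∧ b = 0)) * (2 * stat Y (fun r b => 1 ≤ r ∧ 1 ≤ b)))
    (hC1 : (stat Y (fun r _ => r = 0) + stat Y (fun _ b => b = 0) + 2 * stat Y (fun r b => r = 0 ∧ b = 0)) * stat Y (fun _ b => 2 ≤ b)
      ≤ (stat Y (fun _ b => b = 1) + 2 * stat Y (fun r b => 1 ≤ b ∧ r = 0)) * (stat Y (fun _ b => b = 1) + 2 * stat Y (fun r b => 1 ≤ b ∧ r = 0))
        + (stat Y (fun _ b => b = 1) + 2 * stat Y (fun r b => 1 ≤ b ∧ r = 0)) * (2 * stat Y (fun r b => 1 ≤ r ∧ 1 ≤ b)))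
    (hΛa : (stat Y (fun r _ => r = 0) + stat Y (fun _ b => b = 0) + 2 * stat Y (fun r b => r = 0 ∧ b = 0)) * (2 * stat Y (fun r b => 1 ≤ r ∧ 1 ≤ b))
      ≤ (stat Y (fun r _ => r = 1) + 2 * stat Y (fun r b => 1 ≤ r ∧ b = 0)) * (stat Y (fun _ b => b = 1) + 2 * stat Y (fun r b => 1 ≤ b ∧ r = 0))
        + (stat Y (fun _ b => b = 1) + 2 * stat Y (fun r b => 1 ≤ b ∧ r = 0)) * stat Y (fun r _ => 2 ≤ r))
    (hΛb : (stat Y (fun r _ => r = 0) + stat Y (fun _ b => b = 0) + 2 * stat Y (fun r b => r = 0 ∧ b = 0)) * (2 * stat Y (fun r b => 1 ≤ r ∧ 1 ≤ b))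
      ≤ (stat Y (fun r _ => r = 1) + 2 * stat Y (fun r b => 1 ≤ r ∧ b = 0)) * (stat Y (fun _ b => b = 1) + 2 * stat Y (fun r b => 1 ≤ b ∧ r = 0))
        + (stat Y (fun r _ => r = 1) + 2 * stat Y (fun r b => 1 ≤ r ∧ b = 0)) * stat Y (fun _ b => 2 ≤ b)) :
    MTailPat (.par s (p2ser Y)) (L + 2) ∧ MTailPat (.par (p2ser Y) s) (L + 2) := by
  obtain ⟨c20, c02, c11, c10, c01, c00⟩ := p2ser_counts Y
  have t20 : ∃ y : (p2ser Y).Conf, (p2ser Y).rLab y = 2 ∧ (p2ser Y).bLab y = 0 := by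
    obtain ⟨y, hy⟩ := h20
    exact ⟨((false, false), y), by simp [p2ser, SP.rLab, SP.bLab, serR, serB, parR, parB]; omega⟩
  have t02 : ∃ y : (p2ser Y).Conf, (p2ser Y).rLab y = 0 ∧ (p2ser Y).bLab y = 2 := by
    obtain ⟨y, hy⟩ := h02
    exact ⟨((true, true), y), by simp [p2ser, SP.rLab, SP.bLab, serR, serB, parR, parB]; omega⟩
  have t11 : ∃ y : (p2ser Y).Conf, (p2ser Y).rLab y = 1 ∧ (p2ser Y).bLab y = 1 := by
    obtain ⟨y, hy⟩ := h11
    exact ⟨((false, true), y), by simp [p2ser, SP.rLab, SP.bLab, serR, serB, parR, parB]; omega⟩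
  refine MTailPat.par_flow2' hs (p2ser Y) (p2ser_flowLeTwo Y) t20 t11 t02 ?_ ?_ ?_ ?_ ?_ ?_ ?_ ?_ ?_ <;>
    simp only [c20, c02, c11, c10, c01, c00] <;> assumption

end Summit.Ventures.PercRepro2.Tail2D
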